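import Literature.Analysis.FluidPDE.CKNPressureDuality
import HarnessLib

/-!
# The harmonic part of the tested pressure: `‖∫∫ p Λθ‖` (towards (13.20)–(13.21))

Analysis/FluidPDE support file (all results proved) in the decomposition of the named fact
`Literature.Analysis.FluidPDE.LemarieRieusset2016.pressure_localIntegrability`
(`CKNMorreyLemmas.lean`; Lemarié-Rieusset 2016, (13.19)–(13.21), p. 461). Companion of
`CKNPressureDuality`: there the pressure tested with `θ ∈ C_c^∞(I × B(x_B, R))` was rewritten as
`∫∫_Ω p θ = ∫∫_Ω p Λθ - ∫∫_Ω D²Θ(u,u)` with the smoothing remainder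
`Λθ(t, x) = ∫ λ(z) θ(t, x - z) dz`, `λ = λ_{ρ/2,ρ}` smooth, bounded and supported in `|z| ≤ ρ`
(`newtonFarSmoothing`, `newtonFarLaplacian`). This is the part of the pressure which in print is
`p_B ∈ L^{q₀}_t L^∞_x` ((13.20): "`|p_B(t,x)| ≤ C r_B⁻³ ∫_{B(x_B,2r_B)} |p(t,y)| dy`"); in dual
form it reads (`enorm_setIntegral_mul_newtonFarSmoothing_le`)

  `‖∫∫_Ω p Λθ‖ ≤ L |B|^{1 - 1/q'} (∫_I (∫_{Ω_t} |p|)^q dt)^{1/q} ‖θ‖_{L^{q'}(I × B)}`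

for conjugate exponents `q, q'` and `|λ| ≤ L`: pointwise `|Λθ(t,x)| ≤ L ‖θ(t,·)‖_{L¹}`, then
Tonelli, Hölder in `t` over `I` with exponents `(q', q)` and Hölder in `x` over `B`
(`‖θ(t,·)‖_{L¹} ≤ |B|^{1-1/q'} ‖θ(t,·)‖_{L^{q'}}`). Only the pressure class
`p ∈ L^{q₀}_t L¹_x(Ω)` of `(ℋ_CKN)` enters (through `∫_I (∫_{Ω_t}|p|)^q ≤ ∞` for `q ≤ q₀`).

## References

* P. G. Lemarié-Rieusset, *The Navier–Stokes Problem in the 21st Century*, CRC Press (2016),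
  (13.20)–(13.21) p. 461. [LemarieRieusset2016]
-/

noncomputable section

open MeasureTheory Set Function Filter Topology TopologicalSpace Metric InnerProductSpace
open scoped ENNReal NNReal RealInnerProductSpace ContDiff

namespace Literature.Analysis.FluidPDE

variable {Ω : Opens (ℝ × EuclideanSpace ℝ (Fin 3))} {p : ℝ → EuclideanSpace ℝ (Fin 3) → ℝ}
  {a b R ρ : ℝ} {xB : EuclideanSpace ℝ (Fin 3)} {θ : ℝ → EuclideanSpace ℝ (Fin 3) → ℝ}

/-! ### Hölder against `1` on a set, non-strict exponents -/

/-- Hölder's inequality against the constant `1` on a set, for `0 < a ≤ c`: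
`∫_s F^a ≤ (∫_s F^c)^{a/c} μ(s)^{1 - a/c}` (the case `a = c` is an equality). [folklore] -/
theorem setLIntegral_rpow_le_rpow_mul_measure_of_le {α : Type*} [MeasurableSpace α]
    (μ : Measure α) (s : Set α) {F : α → ℝ≥0∞} (hF : AEMeasurable F (μ.restrict s)) {a c : ℝ}
    (ha : 0 < a) (hac : a ≤ c) :
    ∫⁻ x in s, F x ^ a ∂μ ≤ (∫⁻ x in s, F x ^ c ∂μ) ^ (a / c) * μ s ^ (1 - a / c) := by
  rcases hac.eq_or_lt with rfl | hlt
  · rw [div_self ha.ne', ENNReal.rpow_one, sub_self, ENNReal.rpow_zero, mul_one]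
  · exact setLIntegral_rpow_le_rpow_mul_measure μ s hF ha hlt

/-! ### Pointwise bound for the smoothing remainder -/

/-- `‖Λ[g](x)‖ₑ ≤ L ∫⁻ ‖g‖ₑ` when `|λ| ≤ L` (translation invariance of Lebesgue measure).
[folklore] -/
theorem enorm_newtonFarSmoothing_half_le {L : ℝ≥0}
    (hL : ∀ z, ‖newtonFarLaplacian (ρ / 2) ρ z‖ ≤ L) (g : EuclideanSpace ℝ (Fin 3) → ℝ)
    (x : EuclideanSpace ℝ (Fin 3)) :
    ‖newtonFarSmoothing (ρ / 2) ρ g x‖ₑ ≤ L * ∫⁻ y, ‖g y‖ₑ := by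
  rw [newtonFarSmoothing_apply]
  calc ‖∫ z, newtonFarLaplacian (ρ / 2) ρ z * g (x - z)‖ₑ
      ≤ ∫⁻ z, ‖newtonFarLaplacian (ρ / 2) ρ z * g (x - z)‖ₑ := enorm_integral_le_lintegral_enorm _
    _ ≤ ∫⁻ z, L * ‖g (x - z)‖ₑ := by
        refine lintegral_mono fun z => ?_
        rw [enorm_mul]
        gcongr
        rw [← ofReal_norm, ← ENNReal.ofReal_coe_nnreal]
        exact ENNReal.ofReal_le_ofReal (hL z)
    _ = L * ∫⁻ z, ‖g (x - z)‖ₑ := lintegral_const_mul' _ _ ENNReal.coe_ne_top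
    _ = L * ∫⁻ y, ‖g y‖ₑ := by rw [lintegral_sub_left_eq_self (fun y => ‖g y‖ₑ) x]

/-! ### The dual bound for the harmonic part -/

/-- **The harmonic part of the pressure, dual form** (Lemarié-Rieusset 2016, (13.20) p. 461,
"`p_B ∈ L^{q₀}_t L^∞_x(I × B)`"). Let `p` be a.e. strongly measurable on the open
`Ω ⊆ ℝ × ℝ³`, `θ ∈ C_c^∞(I × B)` with `I = (a, b)`, `B = B(x_B, R)`, `ρ > 0`, `|λ_{ρ/2,ρ}| ≤ L`, and
`q, q'` conjugate exponents. Then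
`‖∫∫_Ω p Λθ‖ ≤ L |B|^{1-1/q'} (∫_I (∫ 𝟙_Ω |p| (t,x) dx)^q dt)^{1/q} (∫∫_{I×B} |θ|^{q'})^{1/q'}`.
[cite: LemarieRieusset2016, (13.20) p. 461] -/
theorem enorm_setIntegral_mul_newtonFarSmoothing_le
    (hp : AEStronglyMeasurable (uncurry p)
      ((volume : Measure (ℝ × EuclideanSpace ℝ (Fin 3))).restrict Ω))
    {L : ℝ≥0} (hL : ∀ z, ‖newtonFarLaplacian (ρ / 2) ρ z‖ ≤ L)
    (hθ : IsSpaceTimeTestOn (⟨Ioo a b ×ˢ ball xB R, isOpen_Ioo.prod isOpen_ball⟩ :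
      Opens (ℝ × EuclideanSpace ℝ (Fin 3))) θ)
    {q q' : ℝ} (hqq' : q.HolderConjugate q') :
    ‖∫ z in (Ω : Set (ℝ × EuclideanSpace ℝ (Fin 3))),
        p z.1 z.2 * newtonFarSmoothing (ρ / 2) ρ (θ z.1) z.2‖ₑ ≤
      L * volume (ball xB R) ^ (1 - 1 / q') *
        (∫⁻ t in Ioo a b, (∫⁻ x, (Ω : Set (ℝ × EuclideanSpace ℝ (Fin 3))).indicator
          (fun z : ℝ × EuclideanSpace ℝ (Fin 3) => ‖p z.1 z.2‖ₑ) (t, x)) ^ q) ^ (1 / q) *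
        (∫⁻ z in Ioo a b ×ˢ ball xB R, ‖θ z.1 z.2‖ₑ ^ q') ^ (1 / q') := by
  have hq : 0 < q := hqq'.pos
  have hq' : 0 < q' := hqq'.symm.pos
  have hq'1 : 1 < q' := hqq'.symm.lt
  set I : Set ℝ := Ioo a b with hI
  set B : Set (EuclideanSpace ℝ (Fin 3)) := ball xB R with hB
  set S : Set (ℝ × EuclideanSpace ℝ (Fin 3)) := Ioo a b ×ˢ ball xB R with hS
  -- the whole-space integrands
  set P : ℝ × EuclideanSpace ℝ (Fin 3) → ℝ≥0∞ := (Ω : Set (ℝ × EuclideanSpace ℝ (Fin 3))).indicator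
    fun z => ‖p z.1 z.2‖ₑ with hP
  set π : ℝ → ℝ≥0∞ := fun t => ∫⁻ x, P (t, x) with hπ
  set N : ℝ → ℝ≥0∞ := fun t => ∫⁻ y, ‖θ t y‖ₑ with hN
  set Gq : ℝ → ℝ≥0∞ := fun t => ∫⁻ y, ‖θ t y‖ₑ ^ q' with hGq
  -- measurability
  have hPm : AEMeasurable P (volume : Measure (ℝ × EuclideanSpace ℝ (Fin 3))) := by
    have h1 : AEStronglyMeasurable ((Ω : Set (ℝ × EuclideanSpace ℝ (Fin 3))).indicator (uncurry p))
        (volume : Measure (ℝ × EuclideanSpace ℝ (Fin 3))) :=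
      (aestronglyMeasurable_indicator_iff Ω.isOpen.measurableSet).2 hp
    have h2 : P = fun z => ‖(Ω : Set (ℝ × EuclideanSpace ℝ (Fin 3))).indicator (uncurry p) z‖ₑ := by
      funext z
      rw [hP, enorm_indicator_eq_indicator_enorm]
      rfl
    rw [h2]
    exact h1.enorm
  have hπm : AEMeasurable π (volume : Measure ℝ) := by
    rw [Measure.volume_eq_prod] at hPm
    exact hPm.lintegral_prod_right'
  have hθm : Measurable fun z : ℝ × EuclideanSpace ℝ (Fin 3) => ‖θ z.1 z.2‖ₑ :=
    hθ.contDiff.continuous.measurable.enorm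
  have hNm : Measurable N := hθm.lintegral_prod_right'
  -- slices of `θ` vanish for `t ∉ I`, and `θ(t, ·)` is supported in `B`
  have hθ0 : ∀ t x, (t, x) ∉ S → θ t x = 0 := fun t x h => hθ.apply_eq_zero h
  have hθmt : ∀ t, Measurable fun y => ‖θ t y‖ₑ := fun t => hθm.comp measurable_prodMk_left
  have hN0 : ∀ t, t ∉ I → N t = 0 := fun t ht => by
    have h : ∫⁻ y, ‖θ t y‖ₑ = 0 :=
      (lintegral_eq_zero_iff (hθmt t)).2 (Eventually.of_forall fun y => by
        simp [hθ0 t y fun h => ht h.1])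
    exact h
  have hNfin : ∀ t, N t ≠ ⊤ := fun t =>
    (((hθ.contDiff_slice t).continuous.integrable_of_hasCompactSupport
      (hθ.hasCompactSupport_slice t)).hasFiniteIntegral).ne
  -- Step 1: `‖∫_Ω p Λθ‖ ≤ ∫⁻ P ‖Λθ‖ ≤ L ∫⁻_t N(t) π(t)`
  have step1 : ‖∫ z in (Ω : Set (ℝ × EuclideanSpace ℝ (Fin 3))),
      p z.1 z.2 * newtonFarSmoothing (ρ / 2) ρ (θ z.1) z.2‖ₑ ≤ L * ∫⁻ t in I, N t * π t := by
    calc ‖∫ z in (Ω : Set (ℝ × EuclideanSpace ℝ (Fin 3))),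
          p z.1 z.2 * newtonFarSmoothing (ρ / 2) ρ (θ z.1) z.2‖ₑ
        ≤ ∫⁻ z in (Ω : Set (ℝ × EuclideanSpace ℝ (Fin 3))),
            ‖p z.1 z.2 * newtonFarSmoothing (ρ / 2) ρ (θ z.1) z.2‖ₑ :=
          enorm_integral_le_lintegral_enorm _
      _ = ∫⁻ z, P z * ‖newtonFarSmoothing (ρ / 2) ρ (θ z.1) z.2‖ₑ := by
          rw [← lintegral_indicator Ω.isOpen.measurableSet]
          refine lintegral_congr fun z => ?_
          rw [hP]
          by_cases hz : z ∈ (Ω : Set (ℝ × EuclideanSpace ℝ (Fin 3)))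
          · rw [indicator_of_mem hz, indicator_of_mem hz, enorm_mul]
          · rw [indicator_of_notMem hz, indicator_of_notMem hz, zero_mul]
      _ ≤ ∫⁻ z, P z * (L * N z.1) :=
          lintegral_mono fun z => mul_le_mul' le_rfl (enorm_newtonFarSmoothing_half_le hL _ _)
      _ ≤ ∫⁻ t, ∫⁻ x, P (t, x) * (L * N t) := by
          rw [Measure.volume_eq_prod]; exact lintegral_prod_le _
      _ = ∫⁻ t, L * (N t * π t) := by
          refine lintegral_congr fun t => ?_
          rw [lintegral_mul_const' _ _ (ENNReal.mul_ne_top ENNReal.coe_ne_top (hNfin t)), hπ]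
          ring
      _ = L * ∫⁻ t, N t * π t := lintegral_const_mul' _ _ ENNReal.coe_ne_top
      _ = L * ∫⁻ t in I, N t * π t := by
          rw [setLIntegral_eq_of_support_subset]
          intro t ht
          by_contra htI
          exact ht (by simp [hN0 t htI])
  -- Step 2: Hölder in `t` over `I` with exponents `(q', q)`
  have step2 : ∫⁻ t in I, N t * π t ≤
      (∫⁻ t in I, N t ^ q') ^ (1 / q') * (∫⁻ t in I, π t ^ q) ^ (1 / q) :=
    ENNReal.lintegral_mul_le_Lp_mul_Lq _ hqq'.symm hNm.aemeasurable hπm.restrict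
  -- Step 3: Hölder in `x` over `B`: `N(t)^{q'} ≤ |B|^{q'-1} G_{q'}(t)`
  have step3 : ∀ t, N t ^ q' ≤ volume B ^ (q' - 1) * Gq t := fun t => by
    have hsupp : support (fun y => ‖θ t y‖ₑ) ⊆ B := by
      intro y hy
      by_contra hyB
      exact hy (by simp [hθ0 t y fun h => hyB h.2])
    have hsupp' : support (fun y => ‖θ t y‖ₑ ^ q') ⊆ B := by
      intro y hy
      by_contra hyB
      exact hy (by simp [hθ0 t y fun h => hyB h.2, ENNReal.zero_rpow_of_pos hq'])
    have hNt : N t = ∫⁻ y in B, ‖θ t y‖ₑ ^ (1 : ℝ) := by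
      rw [hN]; simp only [ENNReal.rpow_one]
      exact (setLIntegral_eq_of_support_subset hsupp).symm
    have hGt : Gq t = ∫⁻ y in B, ‖θ t y‖ₑ ^ q' := (setLIntegral_eq_of_support_subset hsupp').symm
    have hH := setLIntegral_rpow_le_rpow_mul_measure volume B
      ((hθmt t).aemeasurable (μ := volume.restrict B)) one_pos hq'1
    rw [← hNt, ← hGt] at hH
    calc N t ^ q' ≤ (Gq t ^ ((1 : ℝ) / q') * volume B ^ (1 - 1 / q')) ^ q' :=
          ENNReal.rpow_le_rpow hH hq'.le
      _ = volume B ^ (q' - 1) * Gq t := by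
          rw [ENNReal.mul_rpow_of_nonneg _ _ hq'.le, ← ENNReal.rpow_mul, ← ENNReal.rpow_mul,
            one_div, inv_mul_cancel₀ hq'.ne', ENNReal.rpow_one, sub_mul, one_mul,
            inv_mul_cancel₀ hq'.ne', mul_comm]
  -- Step 4: `∫_I G_{q'} = ∫∫_S |θ|^{q'}`
  have step4 : ∫⁻ t in I, Gq t = ∫⁻ z in S, ‖θ z.1 z.2‖ₑ ^ q' := by
    have hsuppS : support (fun z : ℝ × EuclideanSpace ℝ (Fin 3) => ‖θ z.1 z.2‖ₑ ^ q') ⊆ S := by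
      intro z hz
      by_contra hzS
      exact hz (by simp [hθ0 z.1 z.2 hzS, ENNReal.zero_rpow_of_pos hq'])
    have hsuppI : support Gq ⊆ I := by
      intro t ht
      by_contra htI
      have h : ∫⁻ y, ‖θ t y‖ₑ ^ q' = 0 :=
        (lintegral_eq_zero_iff ((hθmt t).pow_const _)).2 (Eventually.of_forall fun y => by
          simp [hθ0 t y fun h => htI h.1, ENNReal.zero_rpow_of_pos hq'])
      exact ht h
    rw [setLIntegral_eq_of_support_subset hsuppI, setLIntegral_eq_of_support_subset hsuppS,
      Measure.volume_eq_prod, lintegral_prod _ (hθm.pow_const _).aemeasurable]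
  -- assemble
  have hBfin : volume B ^ (q' - 1) ≠ ⊤ :=
    ENNReal.rpow_ne_top_of_nonneg (by linarith) measure_ball_lt_top.ne
  have step5 : (∫⁻ t in I, N t ^ q') ^ (1 / q') ≤
      volume B ^ (1 - 1 / q') * (∫⁻ z in S, ‖θ z.1 z.2‖ₑ ^ q') ^ (1 / q') := by
    calc (∫⁻ t in I, N t ^ q') ^ (1 / q')
        ≤ (∫⁻ t in I, volume B ^ (q' - 1) * Gq t) ^ (1 / q') :=
          ENNReal.rpow_le_rpow (lintegral_mono fun t => step3 t) (by positivity)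
      _ = (volume B ^ (q' - 1) * ∫⁻ z in S, ‖θ z.1 z.2‖ₑ ^ q') ^ (1 / q') := by
          rw [lintegral_const_mul' _ _ hBfin, step4]
      _ = volume B ^ (1 - 1 / q') * (∫⁻ z in S, ‖θ z.1 z.2‖ₑ ^ q') ^ (1 / q') := by
          rw [ENNReal.mul_rpow_of_nonneg _ _ (by positivity), ← ENNReal.rpow_mul]
          congr 2
          field_simp
  calc ‖∫ z in (Ω : Set (ℝ × EuclideanSpace ℝ (Fin 3))),
        p z.1 z.2 * newtonFarSmoothing (ρ / 2) ρ (θ z.1) z.2‖ₑ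
      ≤ L * ∫⁻ t in I, N t * π t := step1
    _ ≤ L * ((∫⁻ t in I, N t ^ q') ^ (1 / q') * (∫⁻ t in I, π t ^ q) ^ (1 / q)) :=
        mul_le_mul' le_rfl step2
    _ ≤ L * ((volume B ^ (1 - 1 / q') * (∫⁻ z in S, ‖θ z.1 z.2‖ₑ ^ q') ^ (1 / q')) *
          (∫⁻ t in I, π t ^ q) ^ (1 / q)) := by gcongr
    _ = L * volume B ^ (1 - 1 / q') * (∫⁻ t in I, π t ^ q) ^ (1 / q) *
          (∫⁻ z in S, ‖θ z.1 z.2‖ₑ ^ q') ^ (1 / q') := by ring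

end Literature.Analysis.FluidPDE
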